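/-
# Profile of a `(2,1)` witness of `SubgroupIdentityDesigns`

Cell B2b-5 (`b2b-lgcu-borel`, generation 14), supporting the crux `SubgroupIdentityDesigns`
(`stmt-MatrixMultiplication-14079`) of the route `LevelGradedCohnUmans`.

HONEST FRAMING.  VALUE = THEOREM (the state of the decidable `(m,k) = (2,1)` cell in one statement)
— NOT summit progress.  Nothing here bears on `ω`.
-/
import Summits.MatrixMultiplication.MatrixMultiplication.Theorems.SubgroupIdentityDesigns.Negative.ThreeSylowLaw
import Summits.MatrixMultiplication.MatrixMultiplication.Theorems.SubgroupIdentityDesigns.Negative.LevelOneFloor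

/-!
## Statement

`levelOne_witness_profile`: for `p ≥ 3` and `0 ≤ ε ≤ 1`, every `(m,k) = (2,1)` witness of the crux
(subgroup TPP + level-`1` identity design + `budget < V^{(2+ε)/3}`) has a member `H` with
`p ∤ |H|`, `p + 1 ≤ |H| ≤ p² - 3` and `|H| ∣ (p - 1)² (p + 1)`.  This packages
`exists_coprime_member_of_witness` (three-Sylow law), `levelOne_witness_window` (master floor) and
`|GL₂(𝔽_p)| = p (p - 1)² (p + 1)` (`card_GL2`, from Mathlib's `Matrix.card_GL_field`).
(`p = 2` has no witness at all for `ε ≤ 1`: `LevelOneDimSqueeze`.)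

So the census of the `(2,1)` cell is reduced, by theorem and for all `p`, to triples with a
p′-member in that window; bounding those needs Dickson-type control of the p′-subgroups of
`GL₂(𝔽_p)` (successor item, `run/shared/lean/b2b/levelgraded-cu/HANDOFF.md` item 25).

Sorry-free; no new definitions.
-/

set_option linter.dupNamespace false

noncomputable section

open scoped BigOperators Classical
open Summit.MatrixMultiplication.MatrixMultiplication.Theorems.LieRankDesigns.Negative
  (GLm Mat budget)

namespace Summit.MatrixMultiplication.MatrixMultiplication.Theorems.SubgroupIdentityDesigns.Negative

section WitnessProfile

open Literature.Barriers.MatrixMultiplication (SubgroupTPP)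

variable {p : ℕ} [hp : Fact p.Prime]

/-- `|GL₂(𝔽_p)| = (p² - 1)(p² - p)`. -/
theorem card_GL2 : Nat.card (GLm p 2) = (p ^ 2 - 1) * (p ^ 2 - p) := by
  rw [Matrix.card_GL_field]
  simp only [ZMod.card, Fin.prod_univ_two, Fin.val_zero, pow_zero, Fin.val_one, pow_one]

/-- `|GL₂(𝔽_p)| = p · ((p - 1)² (p + 1))`. -/
theorem card_GL2' : Nat.card (GLm p 2) = p * ((p - 1) ^ 2 * (p + 1)) := by
  rw [card_GL2]
  have h1 : p ^ 2 - 1 = (p + 1) * (p - 1) := by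
    simpa using Nat.sq_sub_sq p 1
  have h2 : p ^ 2 - p = p * (p - 1) := by
    rw [Nat.mul_sub_one, sq]
  rw [h1, h2]
  ring

/-- A subgroup of `GL₂(𝔽_p)` of order prime to `p` has order dividing `(p - 1)² (p + 1)`. -/
theorem card_dvd_of_not_dvd {H : Subgroup (GLm p 2)} (h : ¬ p ∣ Nat.card H) :
    Nat.card H ∣ (p - 1) ^ 2 * (p + 1) := by
  have hd : Nat.card H ∣ Nat.card (GLm p 2) := Subgroup.card_subgroup_dvd_card H
  rw [card_GL2'] at hd
  have hc : Nat.Coprime (Nat.card H) p :=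
    (Nat.Prime.coprime_iff_not_dvd hp.out).2 h |>.symm
  exact hc.dvd_of_dvd_mul_left hd

/-- **Profile of a `(2,1)` witness.**  For `p ≥ 3` and `0 ≤ ε ≤ 1`, a subgroup TPP triple of
`GL₂(𝔽_p)` carrying a level-`1` identity design and beating the level-`1` budget has a member of
order prime to `p`, inside the window `[p + 1, p² - 3]`, of order dividing `(p - 1)² (p + 1)`. -/
theorem levelOne_witness_profile (hp3 : 3 ≤ p) {ε : ℝ} (hε0 : 0 ≤ ε) (hε1 : ε ≤ 1)
    {H₁ H₂ H₃ : Subgroup (GLm p 2)} (htpp : SubgroupTPP H₁ H₂ H₃)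
    (hdes : ∃ c : Matrix (Fin 2) (Fin 2) (ZMod p) → ℂ, (∀ M, 1 < M.rank → c M = 0) ∧
      (∑ M, c M * ZMod.stdAddChar (Matrix.trace (M * ((1 : GLm p 2) : Mat p 2)))) = 1 ∧
      ∀ a ∈ H₁, ∀ b ∈ H₂, ∀ g ∈ H₃, a * b * g ≠ 1 →
        (∑ M, c M * ZMod.stdAddChar
          (Matrix.trace (M * ((a * b * g : GLm p 2) : Mat p 2)))) = 0)
    (hlt : budget p 2 1 (2 + ε) <
      ((Nat.card H₁ * Nat.card H₂ * Nat.card H₃ : ℕ) : ℝ) ^ ((2 + ε) / 3)) :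
    ∃ H : Subgroup (GLm p 2), (H = H₁ ∨ H = H₂ ∨ H = H₃) ∧ ¬ p ∣ Nat.card H ∧
      p + 1 ≤ Nat.card H ∧ Nat.card H ≤ p ^ 2 - 3 ∧ Nat.card H ∣ (p - 1) ^ 2 * (p + 1) := by
  obtain ⟨w₁, w₂, w₃⟩ := levelOne_witness_window hp3 (by linarith) hε1 htpp hdes hlt
  rcases exists_coprime_member_of_witness hε0 hε1 htpp hlt with h | h | h
  · exact ⟨H₁, Or.inl rfl, h, w₁.1, w₁.2, card_dvd_of_not_dvd h⟩
  · exact ⟨H₂, Or.inr (Or.inl rfl), h, w₂.1, w₂.2, card_dvd_of_not_dvd h⟩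
  · exact ⟨H₃, Or.inr (Or.inr rfl), h, w₃.1, w₃.2, card_dvd_of_not_dvd h⟩

/-- **At most two members of order divisible by `p`, and then the third is confined.**  If two
members of a `(2,1)` witness (`p ≥ 3`, `0 ≤ ε ≤ 1`) have order divisible by `p`, the third has
order prime to `p`, in `[p + 1, p² - 3]`, dividing `(p - 1)² (p + 1)`. -/
theorem third_member_of_two_pMembers (hp3 : 3 ≤ p) {ε : ℝ} (hε0 : 0 ≤ ε) (hε1 : ε ≤ 1)
    {H₁ H₂ H₃ : Subgroup (GLm p 2)} (htpp : SubgroupTPP H₁ H₂ H₃)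
    (hdes : ∃ c : Matrix (Fin 2) (Fin 2) (ZMod p) → ℂ, (∀ M, 1 < M.rank → c M = 0) ∧
      (∑ M, c M * ZMod.stdAddChar (Matrix.trace (M * ((1 : GLm p 2) : Mat p 2)))) = 1 ∧
      ∀ a ∈ H₁, ∀ b ∈ H₂, ∀ g ∈ H₃, a * b * g ≠ 1 →
        (∑ M, c M * ZMod.stdAddChar
          (Matrix.trace (M * ((a * b * g : GLm p 2) : Mat p 2)))) = 0)
    (hlt : budget p 2 1 (2 + ε) <
      ((Nat.card H₁ * Nat.card H₂ * Nat.card H₃ : ℕ) : ℝ) ^ ((2 + ε) / 3))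
    (h₁ : p ∣ Nat.card H₁) (h₂ : p ∣ Nat.card H₂) :
    ¬ p ∣ Nat.card H₃ ∧ p + 1 ≤ Nat.card H₃ ∧ Nat.card H₃ ≤ p ^ 2 - 3 ∧
      Nat.card H₃ ∣ (p - 1) ^ 2 * (p + 1) := by
  obtain ⟨-, -, w₃⟩ := levelOne_witness_window hp3 (by linarith) hε1 htpp hdes hlt
  have h₃ : ¬ p ∣ Nat.card H₃ := by
    rcases exists_coprime_member_of_witness hε0 hε1 htpp hlt with h | h | h
    · exact absurd h₁ h
    · exact absurd h₂ h
    · exact h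
  exact ⟨h₃, w₃.1, w₃.2, card_dvd_of_not_dvd h₃⟩

end WitnessProfile

end Summit.MatrixMultiplication.MatrixMultiplication.Theorems.SubgroupIdentityDesigns.Negative
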